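import Summits.CriticalPhenomena.SAWScalingLimit.Theorems.SAWRenewalTightnessSubseqIdentificationTiltedProductCell
import HarnessLib

/-!
# The tilted martingale identities (line `boundary-area-law`, RS5b′/T2, Π): the cell estimate and its summation

Line `boundary-area-law` of the crux `SubseqIdentification` (stmt-CriticalPhenomena-0783), restriction
reshape (lead c4, r-c4-5), stub `stub_tiltedProductMartingale` (Π) = half of step (T2) of the tilted
[LSW] Theorem 6.5 (G. F. Lawler, O. Schramm, W. Werner, *Conformal restriction: the chordal case*,
J. Amer. Math. Soc. **16** (2003), §5 (5.1)–(5.3) and Prop. 5.3). Sequel of `…TiltedProductCell`,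
for the product `Mⁿ · Lᵏ` (`Mⁿ = imgMartK κ hA hne n`, `Lᵏ = locMartK κ α λ hA hne k`, `n ≤ k`; bounded, adapted:
`integrable_imgMartK_mul_locMartK`, `stronglyAdapted_imgMartK_mul_locMartK`), GIVEN a constant `C` of the
interior estimate (hypothesis `hC`, supplied by `…TiltedProductInterior.exists_abs_integral_mul_prod_le`):

* `abs_setIntegral_prodCell_le` — **the cell estimate**: for `s ≤ u ≤ t₁`, `S ∈ 𝓕_s`, a threshold `κ₀` and a
  small step `h`, `|∫_S (M_{u+h} L_{u+h} − M_u L_u)| ≤ C h√h + (100h/(cₙ/16) + 8κ₀) P(u < imgLocTimeK n < u+h) + K h√h`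
  (cell decomposition `indicator_prod_sub_eq`, past term `integral_prodPast_mul_sub_eq_zero`, defect
  `abs_prodDefect_le` integrated with the oscillation tail and the fourth moment of the running supremum, as
  in `SLEImageLocalMartingale.abs_setIntegral_imgCell_le`);
* `abs_setIntegral_prod_sub_le_of_partition` — the sum over a uniform partition of `[s, t]` (the boundary
  events of `imgLocTimeK n` over distinct cells are disjoint), as in `SLEImageMartingale`.

References: [LSW] §5 (5.1)–(5.3), Prop. 5.3. No named fact is used.
-/

noncomputable section

open MeasureTheory Filter Topology Set Metric Function
open scoped NNReal ENNReal
open Literature.Probability.RandomPlanarGeometry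
open Literature.Probability.Process (preWienerMeasure runSup runSup_nonneg integrable_runSup)

namespace Summit.CriticalPhenomena.SAWScalingLimit.Theorems.SubseqIdentification.BoundaryAreaLaw

open Loewner PathOps

variable {κ : ℝ≥0} {α lam : ℝ} {A : Set ℂ} {hA : IsStarHull A} {hne : A.Nonempty} {n k : ℕ}

/-! ### The product process -/

section Product

/-- `Mⁿ_t · Lᵏ_t` is integrable (bounded: `|Mⁿ| ≤ N₀`, `Lᵏ ∈ [0, 1]`). [folklore] -/
theorem integrable_imgMartK_mul_locMartK (hα : 0 < α) (hlam : 0 ≤ lam) (t : ℝ≥0) :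
    Integrable (fun ω ↦ imgMartK κ hA hne n t ω * locMartK κ α lam hA hne k t ω) preWienerMeasure := by
  obtain ⟨N₀, -, hN₀⟩ := exists_forall_abs_imgMartK_le (κ := κ) hA hne n
  exact (integrable_locMartK hα hlam t).bdd_mul (measurable_imgMartK n t).aestronglyMeasurable
    (Eventually.of_forall fun ω ↦ by rw [Real.norm_eq_abs]; exact hN₀ t ω)

/-- `Mⁿ · Lᵏ` is strongly adapted. [folklore] -/
theorem stronglyAdapted_imgMartK_mul_locMartK (hα : 0 < α) :
    StronglyAdapted brownianFiltration (fun t ω ↦ imgMartK κ hA hne n t ω * locMartK κ α lam hA hne k t ω) := fun t ↦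
  ((stronglyAdapted_imgMartK (κ := κ) (hA := hA) (hne := hne) n) t).mul ((stronglyAdapted_locMartK hα) t)

end Product

/-! ### The integral over one cell -/

section Cell

variable [MeasurableSpace C(ℝ≥0, ℝ)] [BorelSpace C(ℝ≥0, ℝ)]
variable (hκ0 : 0 < κ) (hκ : κ ≤ 8 / 3) (hαdef : α = (6 - κ) / (2 * κ)) (hlamdef : lam = (8 - 3 * κ) * (6 - κ) / (2 * κ))

include hκ0 hκ hαdef hlamdef in
/-- **The product cell estimate in expectation.** Let `C` be a constant of the interior estimate
`exists_abs_integral_mul_prod_le` with horizon `t₁`, `A ⊆ B̄(0, R)`, `n ≤ k`. For `s ≤ u ≤ t₁`, `S ∈ 𝓕_s`, a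
threshold `κ₀ > 0` and a small step `h ≤ 1`:
`|∫_S (M_{u+h} L_{u+h} − M_u L_u)| ≤ C h√h + (100h/(cₙ/16) + 8κ₀) P(u < imgLocTimeK n < u+h) + K h√h`,
`K = K(κ, n, R, t₁, κ₀)` explicit. [cite: LawlerSchrammWerner2003Restriction, §5 (5.1)–(5.3) and Prop. 5.3] -/
theorem abs_setIntegral_prodCell_le (hnk : n ≤ k) {R : ℝ} (hR0 : 0 < R) (hAR : A ⊆ closedBall (0 : ℂ) R)
    {t₁ : ℝ≥0} {C : ℝ}
    (hC : ∀ (u h : ℝ≥0), u ≤ t₁ → 0 < h →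
      (h : ℝ) ≤ 3 * (locLevel n / 2 * (locLevel n / 16) / 4000) ^ 2 / 256 → lam * (h * massBdCell n) ≤ 1 →
      ∀ {g : (ℝ≥0 → ℝ) → ℝ}, Measurable[brownianFiltration u] g → (∀ ω, g ω ∈ Icc (0 : ℝ) 1) →
        (∀ ω, g ω ≠ 0 → (u : WithTop ℝ≥0) < imgLocTimeK κ hA hne n ω) →
        |∫ ω, g ω * ((imageDrvFnK κ A (u + h) (brownianCPath ω) - imageDrvFnK κ A u (brownianCPath ω)) *
            (DFnK κ A (u + h) (brownianCPath ω) ^ α * Real.exp (-(lam * JFnK κ A u h (brownianCPath ω)))))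
            ∂preWienerMeasure| ≤ C * h * Real.sqrt h)
    {s u h : ℝ≥0} (hsu : s ≤ u) (hut : u ≤ t₁) {S : Set (ℝ≥0 → ℝ)} (hS : MeasurableSet[brownianFiltration s] S)
    {κ₀ : ℝ} (hκ₀ : 0 < κ₀) (hh0 : 0 < h) (hh1 : (h : ℝ) ≤ 1)
    (hhc : (h : ℝ) ≤ 3 * (locLevel n / 2 * (locLevel n / 16) / 4000) ^ 2 / 256)
    (hh2 : stepSize κ₀ h ≤ locLevel n * (locLevel n / 16) / 1000)
    (hh4 : (h : ℝ) ≤ (κ₀ / stepSigma / 2) ^ 2 / 2) (hh5 : lam * (h * massBdCell n) ≤ 1) :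
    |∫ ω in S, (imgMartK κ hA hne n (u + h) ω * locMartK κ α lam hA hne k (u + h) ω -
        imgMartK κ hA hne n u ω * locMartK κ α lam hA hne k u ω) ∂preWienerMeasure| ≤
      C * h * Real.sqrt h +
        (100 * h / (locLevel n / 16) + 8 * κ₀) *
          preWienerMeasure.real {ω | (u : WithTop ℝ≥0) < imgLocTimeK κ hA hne n ω ∧
            imgLocTimeK κ hA hne n ω < ((u + h : ℝ≥0) : WithTop ℝ≥0)} +
        ((2 * (((n : ℝ) + 1) + 1160 * (3 * ((n : ℝ) + 1) + 13 * Real.sqrt ((n : ℝ) + 1) + R)) +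
            (15080 * Real.sqrt ((t₁ : ℝ) + 1) + 1160 * R) + 3482 * Real.sqrt κ) * (128 / (κ₀ / stepSigma) ^ 4) +
          3482 * Real.sqrt κ * (18 * ((t₁ : ℝ) + 1) ^ 2)) * h * Real.sqrt h := by
  -- adapted from SLEImageLocalMartingale.lean (`abs_setIntegral_imgCell_le`) and SLERestrictionLocalMartingaleKappa.lean
  haveI := isProbabilityMeasure_preWienerMeasure'
  obtain ⟨hαpos, hlam0⟩ := exponents_pos hκ hαdef hlamdef hκ0
  obtain ⟨hc0, hc1⟩ := locLevel_pos_le n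
  have hσ := stepSigma_pos
  have hSm : MeasurableSet S := brownianFiltration.le s _ hS
  obtain ⟨hEgt_u, hEgt, hElt⟩ := measurableSet_lt_imgLocTimeK (κ := κ) (hA := hA) (hne := hne) n u (u + h)
  obtain ⟨hLm1, hLm0, hYhm, -, -, hCum⟩ := measurable_piecesK (κ := κ) (lam := lam) (hA := hA) (hne := hne) (n := k) hαpos u h
  have hN₀0 : 0 ≤ ((n : ℝ) + 1) + 1160 * (3 * ((n : ℝ) + 1) + 13 * Real.sqrt ((n : ℝ) + 1) + R) := by positivity
  have hQ0 : 0 ≤ 15080 * Real.sqrt ((t₁ : ℝ) + 1) + 1160 * R := by positivity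
  have hM₁0 : (0 : ℝ) ≤ 3482 * Real.sqrt κ := by positivity
  -- the pieces
  set Cu : (ℝ≥0 → ℝ) → ℝ := fun ω ↦ Real.exp (-(lam * IpnK κ hA hne k u ω)) with hCu
  set ΔΦ : (ℝ≥0 → ℝ) → ℝ := fun ω ↦ imageDrvFnK κ A (u + h) (brownianCPath ω) - imageDrvFnK κ A u (brownianCPath ω) with hΔΦ
  set Yh : (ℝ≥0 → ℝ) → ℝ := fun ω ↦ DFnK κ A (u + h) (brownianCPath ω) ^ α *
    Real.exp (-(lam * JFnK κ A u h (brownianCPath ω))) with hYh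
  set g0 : (ℝ≥0 → ℝ) → ℝ := fun ω ↦ S.indicator (fun _ ↦ (1 : ℝ)) ω *
    {ω | (u : WithTop ℝ≥0) < imgLocTimeK κ hA hne n ω}.indicator (fun _ ↦ (1 : ℝ)) ω with hg0
  set g : (ℝ≥0 → ℝ) → ℝ := fun ω ↦ g0 ω * Cu ω with hg
  set a : (ℝ≥0 → ℝ) → ℝ := fun ω ↦ S.indicator (fun _ ↦ (1 : ℝ)) ω * imgMartK κ hA hne n u ω *
    (locMartK κ α lam hA hne k (u + h) ω - locMartK κ α lam hA hne k u ω) with ha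
  set b : (ℝ≥0 → ℝ) → ℝ := fun ω ↦ g0 ω * ((imgMartK κ hA hne n (u + h) ω - imgMartK κ hA hne n u ω) *
    locMartK κ α lam hA hne k (u + h) ω - Cu ω * (ΔΦ ω * Yh ω)) with hb
  -- the weight
  have hg0mu : Measurable[brownianFiltration u] g0 :=
    ((measurable_const (a := (1 : ℝ))).indicator (brownianFiltration.mono hsu _ hS)).mul
      ((measurable_const (a := (1 : ℝ))).indicator hEgt_u)
  have hg0m : Measurable g0 := hg0mu.mono (brownianFiltration.le u) le_rfl
  have hg0_01 : ∀ ω, g0 ω = 0 ∨ g0 ω = 1 := fun ω ↦ by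
    rw [hg0]; simp only
    by_cases h1 : ω ∈ S
    · by_cases h2 : ω ∈ {ω | (u : WithTop ℝ≥0) < imgLocTimeK κ hA hne n ω}
      · rw [Set.indicator_of_mem h1, Set.indicator_of_mem h2]; norm_num
      · rw [Set.indicator_of_mem h1, Set.indicator_of_notMem h2]; norm_num
    · rw [Set.indicator_of_notMem h1, zero_mul]; exact Or.inl rfl
  have hg0T : ∀ ω, g0 ω ≠ 0 → (u : WithTop ℝ≥0) < imgLocTimeK κ hA hne n ω := fun ω hω ↦ by
    by_contra hnot
    exact hω (by rw [hg0]; simp only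
                 rw [Set.indicator_of_notMem (show ω ∉ {ω | (u : WithTop ℝ≥0) < imgLocTimeK κ hA hne n ω} from hnot), mul_zero])
  have hCu01 : ∀ ω, 0 < Cu ω ∧ Cu ω ≤ 1 := fun ω ↦
    ⟨Real.exp_pos _, by rw [hCu]; simp only; rw [Real.exp_le_one_iff, neg_nonpos]; exact mul_nonneg hlam0 (IpnK_nonneg k u ω)⟩
  have hgmu : Measurable[brownianFiltration u] g := hg0mu.mul hCum
  have hgm : Measurable g := hgmu.mono (brownianFiltration.le u) le_rfl
  have hg01 : ∀ ω, g ω ∈ Icc (0 : ℝ) 1 := fun ω ↦ by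
    rw [hg]; simp only
    rcases hg0_01 ω with h | h
    · rw [h, zero_mul]; exact ⟨le_rfl, zero_le_one⟩
    · rw [h, one_mul]; exact ⟨(hCu01 ω).1.le, (hCu01 ω).2⟩
  have hgT : ∀ ω, g ω ≠ 0 → (u : WithTop ℝ≥0) < imgLocTimeK κ hA hne n ω := fun ω hω ↦ by
    refine hg0T ω fun h0 ↦ hω ?_
    rw [hg]; simp only; rw [h0, zero_mul]
  have hg1' : ∀ᵐ ω ∂preWienerMeasure, ‖g ω‖ ≤ 1 := Eventually.of_forall fun ω ↦ by
    rw [Real.norm_eq_abs, abs_of_nonneg (hg01 ω).1]; exact (hg01 ω).2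
  -- the cell decomposition
  have hdec : ∀ ω, S.indicator (fun ω ↦ imgMartK κ hA hne n (u + h) ω * locMartK κ α lam hA hne k (u + h) ω -
      imgMartK κ hA hne n u ω * locMartK κ α lam hA hne k u ω) ω = a ω + g ω * (ΔΦ ω * Yh ω) + b ω := fun ω ↦ by
    simp only [ha, hb, hg, hg0, hCu, hΔΦ, hYh]
    exact indicator_prod_sub_eq S u h ω
  -- integrability
  obtain ⟨-, iΔ, -⟩ := integrable_imageDrv_subK (κ := κ) hA hne hR0 hAR u h
  have hYh01 : ∀ ω, Yh ω ∈ Icc (0 : ℝ) 1 := fun ω ↦ by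
    obtain ⟨-, -, e0, e1⟩ := DFnK_eq (κ := κ) (A := A) (u + h) (brownianCPath ω)
    have c1 : Real.exp (-(lam * JFnK κ A u h (brownianCPath ω))) ≤ 1 := by
      rw [Real.exp_le_one_iff, neg_nonpos]; exact mul_nonneg hlam0 (JFnK_nonneg hA u h _)
    exact ⟨mul_nonneg (Real.rpow_nonneg e0 _) (Real.exp_pos _).le, mul_le_one₀ (Real.rpow_le_one e0 e1 hαpos.le) (Real.exp_pos _).le c1⟩
  have iP : Integrable (fun ω ↦ ΔΦ ω * Yh ω) preWienerMeasure := by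
    have := iΔ.bdd_mul hYhm.aestronglyMeasurable (Eventually.of_forall fun ω ↦ by
      rw [Real.norm_eq_abs, abs_of_nonneg (hYh01 ω).1]; exact (hYh01 ω).2)
    exact this.congr (Eventually.of_forall fun ω ↦ mul_comm _ _)
  have i1 : Integrable (fun ω ↦ g ω * (ΔΦ ω * Yh ω)) preWienerMeasure := iP.bdd_mul hgm.aestronglyMeasurable hg1'
  obtain ⟨N₀, hN0, hN⟩ := exists_forall_abs_imgMartK_le (κ := κ) hA hne n
  have iL : ∀ t, Integrable (locMartK κ α lam hA hne k t) preWienerMeasure := fun t ↦ integrable_locMartK hαpos hlam0 t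
  have iML : ∀ t, Integrable (fun ω ↦ imgMartK κ hA hne n t ω * locMartK κ α lam hA hne k t ω) preWienerMeasure := fun t ↦
    (iL t).bdd_mul (measurable_imgMartK n t).aestronglyMeasurable (Eventually.of_forall fun ω ↦ by
      rw [Real.norm_eq_abs]; exact hN t ω)
  have ia : Integrable a preWienerMeasure := by
    have hFm : AEStronglyMeasurable (fun ω ↦ S.indicator (fun _ ↦ (1 : ℝ)) ω * imgMartK κ hA hne n u ω) preWienerMeasure :=
      ((measurable_const.indicator hSm).mul (measurable_imgMartK n u)).aestronglyMeasurable
    refine ((iL (u + h)).sub (iL u)).bdd_mul (c := N₀) hFm (Eventually.of_forall fun ω ↦ ?_)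
    rw [Real.norm_eq_abs, abs_mul]
    by_cases hω : ω ∈ S
    · rw [Set.indicator_of_mem hω, abs_one, one_mul]; exact hN u ω
    · rw [Set.indicator_of_notMem hω, abs_zero, zero_mul]; exact hN0
  have i2 : Integrable b preWienerMeasure := by
    have : b = fun ω ↦ S.indicator (fun ω ↦ imgMartK κ hA hne n (u + h) ω * locMartK κ α lam hA hne k (u + h) ω -
        imgMartK κ hA hne n u ω * locMartK κ α lam hA hne k u ω) ω - a ω - g ω * (ΔΦ ω * Yh ω) := by
      funext ω; rw [hdec ω]; ring
    rw [this]
    exact ((((iML (u + h)).sub (iML u)).indicator hSm).sub ia).sub i1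
  have hsplit : ∫ ω in S, (imgMartK κ hA hne n (u + h) ω * locMartK κ α lam hA hne k (u + h) ω -
      imgMartK κ hA hne n u ω * locMartK κ α lam hA hne k u ω) ∂preWienerMeasure =
      ∫ ω, a ω ∂preWienerMeasure + ∫ ω, g ω * (ΔΦ ω * Yh ω) ∂preWienerMeasure + ∫ ω, b ω ∂preWienerMeasure := by
    have iag : Integrable (fun ω ↦ a ω + g ω * (ΔΦ ω * Yh ω)) preWienerMeasure := ia.add i1
    rw [← integral_indicator hSm, ← integral_add ia i1, ← integral_add iag i2]
    exact integral_congr_ae (Eventually.of_forall hdec)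
  have hpast : ∫ ω, a ω ∂preWienerMeasure = 0 :=
    integral_prodPast_mul_sub_eq_zero (hA := hA) (hne := hne) (n := n) (k := k) hκ0 hκ hαdef hlamdef (h := h) hsu hS
  rw [hsplit, hpast, zero_add]
  -- (I) the interior term
  have hI : |∫ ω, g ω * (ΔΦ ω * Yh ω) ∂preWienerMeasure| ≤ C * h * Real.sqrt h := hC u h hut hh0 hhc hh5 hgmu hg01 hgT
  -- (II) the defect
  have hEm : MeasurableSet {ω | (u : WithTop ℝ≥0) < imgLocTimeK κ hA hne n ω ∧
      imgLocTimeK κ hA hne n ω < ((u + h : ℝ≥0) : WithTop ℝ≥0)} := hEgt.inter hElt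
  have hBadm : MeasurableSet {ω | κ₀ / stepSigma ≤ oscFn h (incr u (brownianCPath ω))} :=
    measurableSet_le measurable_const ((measurable_oscFn h).comp ((measurable_incr u).comp measurable_brownianCPath))
  have hk : 0 < κ₀ / stepSigma := div_pos hκ₀ hσ
  have hl : (0 : ℝ) < 1 / Real.sqrt h := by have : (0:ℝ) < Real.sqrt h := Real.sqrt_pos.2 (by exact_mod_cast hh0); positivity
  obtain ⟨iBX, hBX⟩ := integral_indicator_oscFn_mul_runSup_le h u hk hh4 hl
  have hpt : ∀ ω, |b ω| ≤ {ω | (u : WithTop ℝ≥0) < imgLocTimeK κ hA hne n ω ∧ imgLocTimeK κ hA hne n ω < ((u + h : ℝ≥0) : WithTop ℝ≥0)}.indicator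
          (fun _ ↦ 100 * (h : ℝ) / (locLevel n / 16) + 8 * κ₀) ω +
        (2 * (((n : ℝ) + 1) + 1160 * (3 * ((n : ℝ) + 1) + 13 * Real.sqrt ((n : ℝ) + 1) + R)) +
            (15080 * Real.sqrt ((t₁ : ℝ) + 1) + 1160 * R)) *
          {ω | κ₀ / stepSigma ≤ oscFn h (incr u (brownianCPath ω))}.indicator (fun _ ↦ (1 : ℝ)) ω +
        3482 * Real.sqrt κ * ({ω | κ₀ / stepSigma ≤ oscFn h (incr u (brownianCPath ω))}.indicator (fun _ ↦ (1 : ℝ)) ω *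
          runSup (u + h) ω) := by
    intro ω
    by_cases hg0z : g0 ω = 0
    · rw [hb]; simp only
      rw [hg0z, zero_mul, abs_zero]
      have hD0 : 0 ≤ 100 * (h : ℝ) / (locLevel n / 16) + 8 * κ₀ := by positivity
      have := Set.indicator_nonneg (fun _ _ ↦ hD0)
        (s := {ω | (u : WithTop ℝ≥0) < imgLocTimeK κ hA hne n ω ∧ imgLocTimeK κ hA hne n ω < ((u + h : ℝ≥0) : WithTop ℝ≥0)}) ω
      have := Set.indicator_nonneg (fun _ _ ↦ zero_le_one (α := ℝ)) (s := {ω | κ₀ / stepSigma ≤ oscFn h (incr u (brownianCPath ω))}) ω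
      have := runSup_nonneg (u + h) ω
      positivity
    · rcases hg0_01 ω with h0 | h1
      · exact absurd h0 hg0z
      rw [hb]; simp only; rw [h1, one_mul]
      exact abs_prodDefect_le hκ hαpos hlam0 hnk hR0 hAR hut hh0 hh1 hκ₀ hh2 (hg0T ω hg0z)
  have hII := abs_integral_le_of_three_indicator hEm hBadm i2 iBX hpt
  -- arithmetic
  have hPBad : preWienerMeasure.real {ω | κ₀ / stepSigma ≤ oscFn h (incr u (brownianCPath ω))} ≤
      128 * (h : ℝ) ^ 2 / (κ₀ / stepSigma) ^ 4 := measureReal_oscFn_incr_ge_le h u hk hh4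
  obtain ⟨hhs, hls, hl3⟩ := sqrt_cell_arith (h := (h : ℝ)) (by exact_mod_cast hh0) hh1
  have hhs0 : 0 ≤ (h : ℝ) * Real.sqrt h := by positivity
  have hk4 : 0 ≤ 128 / (κ₀ / stepSigma) ^ 4 := by positivity
  have hp1 : 128 * (h : ℝ) ^ 2 / (κ₀ / stepSigma) ^ 4 ≤ 128 / (κ₀ / stepSigma) ^ 4 * (h * Real.sqrt h) := by
    rw [show 128 * (h : ℝ) ^ 2 / (κ₀ / stepSigma) ^ 4 = 128 / (κ₀ / stepSigma) ^ 4 * h ^ 2 by ring]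
    exact mul_le_mul_of_nonneg_left hhs hk4
  have huh : ((u + h : ℝ≥0) : ℝ) ^ 2 ≤ ((t₁ : ℝ) + 1) ^ 2 := by
    have huh' : ((u + h : ℝ≥0) : ℝ) ≤ (t₁ : ℝ) + 1 := by push_cast; exact add_le_add (by exact_mod_cast hut) hh1
    exact pow_le_pow_left₀ (by positivity) huh' 2
  have hJ : ∫ ω, {ω | κ₀ / stepSigma ≤ oscFn h (incr u (brownianCPath ω))}.indicator (fun _ ↦ (1 : ℝ)) ω * runSup (u + h) ω
      ∂preWienerMeasure ≤ 128 / (κ₀ / stepSigma) ^ 4 * (h * Real.sqrt h) + 18 * ((t₁ : ℝ) + 1) ^ 2 * (h * Real.sqrt h) := by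
    refine hBX.trans ?_
    have e1 : 1 / Real.sqrt h * (128 * (h : ℝ) ^ 2 / (κ₀ / stepSigma) ^ 4) = 128 / (κ₀ / stepSigma) ^ 4 * (h * Real.sqrt h) := by
      rw [← hls]; ring
    have e2 : 18 * ((u + h : ℝ≥0) : ℝ) ^ 2 / (1 / Real.sqrt h) ^ 3 = 18 * ((u + h : ℝ≥0) : ℝ) ^ 2 * (h * Real.sqrt h) := by
      rw [div_eq_mul_one_div, hl3]
    rw [e1, e2]
    nlinarith [huh, hhs0]
  have hjunk : (2 * (((n : ℝ) + 1) + 1160 * (3 * ((n : ℝ) + 1) + 13 * Real.sqrt ((n : ℝ) + 1) + R)) +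
        (15080 * Real.sqrt ((t₁ : ℝ) + 1) + 1160 * R)) *
        preWienerMeasure.real {ω | κ₀ / stepSigma ≤ oscFn h (incr u (brownianCPath ω))} +
      3482 * Real.sqrt κ * ∫ ω, {ω | κ₀ / stepSigma ≤ oscFn h (incr u (brownianCPath ω))}.indicator (fun _ ↦ (1 : ℝ)) ω *
        runSup (u + h) ω ∂preWienerMeasure ≤
      ((2 * (((n : ℝ) + 1) + 1160 * (3 * ((n : ℝ) + 1) + 13 * Real.sqrt ((n : ℝ) + 1) + R)) +
            (15080 * Real.sqrt ((t₁ : ℝ) + 1) + 1160 * R) + 3482 * Real.sqrt κ) * (128 / (κ₀ / stepSigma) ^ 4) +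
          3482 * Real.sqrt κ * (18 * ((t₁ : ℝ) + 1) ^ 2)) * h * Real.sqrt h := by
    have a1 := mul_le_mul_of_nonneg_left (hPBad.trans hp1) (by positivity :
      (0 : ℝ) ≤ 2 * (((n : ℝ) + 1) + 1160 * (3 * ((n : ℝ) + 1) + 13 * Real.sqrt ((n : ℝ) + 1) + R)) +
        (15080 * Real.sqrt ((t₁ : ℝ) + 1) + 1160 * R))
    have a2 := mul_le_mul_of_nonneg_left hJ hM₁0
    calc _ ≤ (2 * (((n : ℝ) + 1) + 1160 * (3 * ((n : ℝ) + 1) + 13 * Real.sqrt ((n : ℝ) + 1) + R)) +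
          (15080 * Real.sqrt ((t₁ : ℝ) + 1) + 1160 * R)) * (128 / (κ₀ / stepSigma) ^ 4 * (h * Real.sqrt h)) +
          3482 * Real.sqrt κ * (128 / (κ₀ / stepSigma) ^ 4 * (h * Real.sqrt h) + 18 * ((t₁ : ℝ) + 1) ^ 2 * (h * Real.sqrt h)) :=
          add_le_add a1 a2
      _ = _ := by ring
  calc |∫ ω, g ω * (ΔΦ ω * Yh ω) ∂preWienerMeasure + ∫ ω, b ω ∂preWienerMeasure|
      ≤ |∫ ω, g ω * (ΔΦ ω * Yh ω) ∂preWienerMeasure| + |∫ ω, b ω ∂preWienerMeasure| := abs_add_le _ _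
    _ ≤ _ := by linarith [hI, hII, hjunk]

end Cell

/-! ### Telescoping over a partition -/

section Partition

variable [MeasurableSpace C(ℝ≥0, ℝ)] [BorelSpace C(ℝ≥0, ℝ)]
variable (hκ0 : 0 < κ) (hκ : κ ≤ 8 / 3) (hαdef : α = (6 - κ) / (2 * κ)) (hlamdef : lam = (8 - 3 * κ) * (6 - κ) / (2 * κ))

include hκ0 hκ hαdef hlamdef in
/-- **Summing the product cell estimates over a uniform partition of `[s, t]` into `N` cells of length `h`**
(`t ≤ t₁`, the horizon of the interior constant `C`; the boundary events of `imgLocTimeK n` over distinct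
cells are disjoint). [folklore] -/
theorem abs_setIntegral_prod_sub_le_of_partition (hnk : n ≤ k) {R : ℝ} (hR0 : 0 < R) (hAR : A ⊆ closedBall (0 : ℂ) R)
    {t₁ : ℝ≥0} {C : ℝ}
    (hC : ∀ (u h : ℝ≥0), u ≤ t₁ → 0 < h →
      (h : ℝ) ≤ 3 * (locLevel n / 2 * (locLevel n / 16) / 4000) ^ 2 / 256 → lam * (h * massBdCell n) ≤ 1 →
      ∀ {g : (ℝ≥0 → ℝ) → ℝ}, Measurable[brownianFiltration u] g → (∀ ω, g ω ∈ Icc (0 : ℝ) 1) →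
        (∀ ω, g ω ≠ 0 → (u : WithTop ℝ≥0) < imgLocTimeK κ hA hne n ω) →
        |∫ ω, g ω * ((imageDrvFnK κ A (u + h) (brownianCPath ω) - imageDrvFnK κ A u (brownianCPath ω)) *
            (DFnK κ A (u + h) (brownianCPath ω) ^ α * Real.exp (-(lam * JFnK κ A u h (brownianCPath ω)))))
            ∂preWienerMeasure| ≤ C * h * Real.sqrt h)
    {s t : ℝ≥0} (hst : s ≤ t) (ht₁ : t ≤ t₁) {S : Set (ℝ≥0 → ℝ)} (hS : MeasurableSet[brownianFiltration s] S)
    {κ₀ : ℝ} (hκ₀ : 0 < κ₀) {N : ℕ} {h : ℝ≥0} (hhN : (N : ℝ≥0) * h = t - s) (hh0 : 0 < h) (hh1 : (h : ℝ) ≤ 1)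
    (hhc : (h : ℝ) ≤ 3 * (locLevel n / 2 * (locLevel n / 16) / 4000) ^ 2 / 256)
    (hh2 : stepSize κ₀ h ≤ locLevel n * (locLevel n / 16) / 1000)
    (hh4 : (h : ℝ) ≤ (κ₀ / stepSigma / 2) ^ 2 / 2) (hh5 : lam * (h * massBdCell n) ≤ 1) :
    |∫ ω in S, (imgMartK κ hA hne n t ω * locMartK κ α lam hA hne k t ω -
        imgMartK κ hA hne n s ω * locMartK κ α lam hA hne k s ω) ∂preWienerMeasure| ≤
      N * (C * h * Real.sqrt h) + (100 * h / (locLevel n / 16) + 8 * κ₀) +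
        N * (((2 * (((n : ℝ) + 1) + 1160 * (3 * ((n : ℝ) + 1) + 13 * Real.sqrt ((n : ℝ) + 1) + R)) +
            (15080 * Real.sqrt ((t₁ : ℝ) + 1) + 1160 * R) + 3482 * Real.sqrt κ) * (128 / (κ₀ / stepSigma) ^ 4) +
          3482 * Real.sqrt κ * (18 * ((t₁ : ℝ) + 1) ^ 2)) * h * Real.sqrt h) := by
  -- adapted from SLEImageMartingale.lean (`abs_setIntegral_imgMartK_sub_le_of_partition`)
  haveI := isProbabilityMeasure_preWienerMeasure'
  obtain ⟨hαpos, hlam0⟩ := exponents_pos hκ hαdef hlamdef hκ0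
  have hc0 := (locLevel_pos_le n).1
  have hSm : MeasurableSet S := brownianFiltration.le s _ hS
  set X : ℝ≥0 → (ℝ≥0 → ℝ) → ℝ := fun t ω ↦ imgMartK κ hA hne n t ω * locMartK κ α lam hA hne k t ω with hX
  set K : ℝ := ((2 * (((n : ℝ) + 1) + 1160 * (3 * ((n : ℝ) + 1) + 13 * Real.sqrt ((n : ℝ) + 1) + R)) +
      (15080 * Real.sqrt ((t₁ : ℝ) + 1) + 1160 * R) + 3482 * Real.sqrt κ) * (128 / (κ₀ / stepSigma) ^ 4) +
    3482 * Real.sqrt κ * (18 * ((t₁ : ℝ) + 1) ^ 2)) with hK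
  set D : ℝ := 100 * h / (locLevel n / 16) + 8 * κ₀ with hD
  have hD0 : 0 ≤ D := by positivity
  set u : ℕ → ℝ≥0 := fun i ↦ s + (i : ℝ≥0) * h with hu
  have hu0 : u 0 = s := by simp [hu]
  have huN : u N = t := by rw [hu]; simp only; rw [hhN, add_tsub_cancel_of_le hst]
  have husucc : ∀ i, u (i + 1) = u i + h := fun i ↦ by simp only [hu]; push_cast; ring
  have hsu : ∀ i, s ≤ u i := fun i ↦ by simp only [hu]; exact le_self_add
  have hut : ∀ i, i < N → u i ≤ t₁ := fun i hi ↦ by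
    refine le_trans ?_ ht₁
    rw [← huN]; simp only [hu]
    gcongr
  -- integrability of the product
  obtain ⟨N₀, -, hN₀⟩ := exists_forall_abs_imgMartK_le (κ := κ) hA hne n
  have hint : ∀ i, Integrable (X (u i)) preWienerMeasure := fun i ↦
    (integrable_locMartK hαpos hlam0 _).bdd_mul (measurable_imgMartK n _).aestronglyMeasurable
      (Eventually.of_forall fun ω ↦ by rw [Real.norm_eq_abs]; exact hN₀ _ ω)
  -- telescoping
  have htel : ∫ ω in S, (X t ω - X s ω) ∂preWienerMeasure =
      ∑ i ∈ Finset.range N, ∫ ω in S, (X (u (i + 1)) ω - X (u i) ω) ∂preWienerMeasure := by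
    have e1 : (fun ω ↦ X t ω - X s ω) = fun ω ↦ ∑ i ∈ Finset.range N, (X (u (i + 1)) ω - X (u i) ω) := by
      funext ω; rw [Finset.sum_range_sub (fun i ↦ X (u i) ω), huN, hu0]
    have hint' : ∀ i ∈ Finset.range N, Integrable (fun ω ↦ X (u (i + 1)) ω - X (u i) ω) (preWienerMeasure.restrict S) :=
      fun i _ ↦ ((hint (i + 1)).sub (hint i)).integrableOn
    rw [e1]
    exact integral_finsetSum (Finset.range N) (f := fun i ω ↦ X (u (i + 1)) ω - X (u i) ω) hint'
  show |∫ ω in S, (X t ω - X s ω) ∂preWienerMeasure| ≤ _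
  rw [htel]
  -- the boundary events are pairwise disjoint
  set E : ℕ → Set (ℝ≥0 → ℝ) := fun i ↦ {ω | ((u i : ℝ≥0) : WithTop ℝ≥0) < imgLocTimeK κ hA hne n ω ∧
    imgLocTimeK κ hA hne n ω < ((u i + h : ℝ≥0) : WithTop ℝ≥0)} with hE
  have hEm : ∀ i, MeasurableSet (E i) := fun i ↦ by
    obtain ⟨-, h1, h2⟩ := measurableSet_lt_imgLocTimeK (κ := κ) (hA := hA) (hne := hne) n (u i) (u i + h)
    exact h1.inter h2
  have hdisj : Set.PairwiseDisjoint (↑(Finset.range N) : Set ℕ) E := by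
    intro i _ j _ hij
    rw [Function.onFun, Set.disjoint_left]
    rintro ω ⟨hi1, hi2⟩ ⟨hj1, hj2⟩
    have hh0' : (0 : ℝ) < h := hh0
    have hji : u j < u i + h := by have := hj1.trans hi2; exact_mod_cast this
    have hij' : u i < u j + h := by have := hi1.trans hj2; exact_mod_cast this
    have hji_r : (s : ℝ) + j * h < s + i * h + h := by have := hji; simp only [hu] at this; exact_mod_cast this
    have hij_r : (s : ℝ) + i * h < s + j * h + h := by have := hij'; simp only [hu] at this; exact_mod_cast this
    rcases lt_or_gt_of_ne hij with hlt | hlt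
    · have : (i : ℝ) + 1 ≤ j := by exact_mod_cast hlt
      nlinarith
    · have : (j : ℝ) + 1 ≤ i := by exact_mod_cast hlt
      nlinarith
  have hsumE : ∑ i ∈ Finset.range N, preWienerMeasure.real (E i) ≤ 1 := by
    have := sum_measureReal_le_measureReal_univ (μ := preWienerMeasure) (s := Finset.range N) (fun i _ ↦ hEm i) hdisj
    rwa [probReal_univ] at this
  -- sum the cell estimates
  have hcell : ∀ i ∈ Finset.range N, |∫ ω in S, (X (u (i + 1)) ω - X (u i) ω) ∂preWienerMeasure| ≤
      C * h * Real.sqrt h + D * preWienerMeasure.real (E i) + K * h * Real.sqrt h := fun i hi ↦ by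
    rw [husucc]
    exact abs_setIntegral_prodCell_le hκ0 hκ hαdef hlamdef hnk hR0 hAR hC (hsu i) (hut i (Finset.mem_range.1 hi)) hS hκ₀ hh0
      hh1 hhc hh2 hh4 hh5
  calc |∑ i ∈ Finset.range N, ∫ ω in S, (X (u (i + 1)) ω - X (u i) ω) ∂preWienerMeasure|
      ≤ ∑ i ∈ Finset.range N, |∫ ω in S, (X (u (i + 1)) ω - X (u i) ω) ∂preWienerMeasure| := Finset.abs_sum_le_sum_abs _ _
    _ ≤ ∑ i ∈ Finset.range N, (C * h * Real.sqrt h + D * preWienerMeasure.real (E i) + K * h * Real.sqrt h) := Finset.sum_le_sum hcell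
    _ = N * (C * h * Real.sqrt h) + D * ∑ i ∈ Finset.range N, preWienerMeasure.real (E i) + N * (K * h * Real.sqrt h) := by
        rw [Finset.sum_add_distrib, Finset.sum_add_distrib, Finset.sum_const, Finset.sum_const, Finset.card_range, ← Finset.mul_sum]
        simp [nsmul_eq_mul]
    _ ≤ _ := by
        have := mul_le_mul_of_nonneg_left hsumE hD0
        linarith

end Partition

section Registered

/-- **Registered form** (explicit binders) of `integrable_imgMartK_mul_locMartK`: the product `Mⁿ_t · Lᵏ_t` is
integrable (`α > 0`, `λ ≥ 0`). [folklore] -/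
theorem integrable_imgMartK_mul_locMartK_registered :
    ∀ (κ : ℝ≥0) (α lam : ℝ) (A : Set ℂ) (hA : IsStarHull A) (hne : A.Nonempty) (n k : ℕ), 0 < α → 0 ≤ lam →
      ∀ (t : ℝ≥0), Integrable (fun ω => imgMartK κ hA hne n t ω * locMartK κ α lam hA hne k t ω) preWienerMeasure :=
  fun _ _ _ _ _ _ _ _ hα hlam t ↦ integrable_imgMartK_mul_locMartK hα hlam t

end Registered

end Summit.CriticalPhenomena.SAWScalingLimit.Theorems.SubseqIdentification.BoundaryAreaLaw

end
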